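import Summits.Ventures.PercRepro.S2ClusterLever

/-!
# PercRepro — S2: THE CLUSTER LEVER, PART B — THE CLUSTERS OF THE SPREAD CORE AND THE TOP-SET COUNT THROUGH THEM (p7, gen 15 / 16)

The second half of gen 15's `S2ClusterLever` (split at the gate's 400-line rule; the statements are byte-identical to the g15 lane):
**`exists_clusters_of_no_three_disjoint`** (`t ≥ 6`, no three pairwise disjoint triangles ⇒ two disjoint clusters of nullities
`3 / 3` or `3 / 2`), **`top_sets_le_of_clusters`** (the top `5`- and `6`-sets counted through two disjoint clusters), and
**`ncard_cluster_le_six_of_three_meeting`** (three triangles through a point and a fourth meeting them span a `6`-point cluster).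
Nothing about any cell is claimed. Axioms: standard.
-/

open scoped Matroid

namespace PercRepro

namespace S2

open Set

variable {α : Type}

/-- **THE TWO CLUSTERS**: on a spread core with `t ≥ 6` triangles and no three pairwise disjoint ones, there are disjoint
`W₁, W₂ ⊆ E` of `≤ 7` points each with nullities `k₁, k₂ ∈ {2, 3}`, `k₁ + k₂ ≥ 5` (a cluster of nullity `2` has `≤ 5` points), and
`k₁ = k₂ = 3` once `t ≥ 7`. -/
theorem exists_clusters_of_no_three_disjoint (M : Matroid α) [M.Finite]
    (hC1 : ∀ L ⊆ M.E, M.eRk L = 2 → L.ncard ≤ 3)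
    (h9 : ∀ X ⊆ M.E, X.ncard ≤ 9 → X.encard ≤ M.eRk X + 3)
    (ht6 : 6 ≤ {C : Set α | M.IsCircuit C ∧ C.ncard = 3}.ncard)
    (hno : ¬ ∃ T₁ T₂ T₃ : Set α, M.IsCircuit T₁ ∧ T₁.ncard = 3 ∧ M.IsCircuit T₂ ∧ T₂.ncard = 3 ∧
      M.IsCircuit T₃ ∧ T₃.ncard = 3 ∧ Disjoint T₁ T₂ ∧ Disjoint T₁ T₃ ∧ Disjoint T₂ T₃) :
    ∃ W₁ W₂ : Set α, ∃ k₁ k₂ : ℕ, W₁ ⊆ M.E ∧ W₂ ⊆ M.E ∧ Disjoint W₁ W₂ ∧ W₁.ncard ≤ 7 ∧ W₂.ncard ≤ 7 ∧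
      M.eRk W₁ + k₁ ≤ W₁.encard ∧ M.eRk W₂ + k₂ ≤ W₂.encard ∧
      ((k₁ = 3 ∧ k₂ = 3) ∨ (k₁ = 3 ∧ k₂ = 2 ∧ W₂.ncard ≤ 5) ∨ (k₁ = 2 ∧ k₂ = 3 ∧ W₁.ncard ≤ 5)) ∧
      (7 ≤ {C : Set α | M.IsCircuit C ∧ C.ncard = 3}.ncard → k₁ = 3 ∧ k₂ = 3) := by
  classical
  set 𝒯 := {C : Set α | M.IsCircuit C ∧ C.ncard = 3} with h𝒯
  have h𝒯fin : 𝒯.Finite := M.ground_finite.finite_subsets.subset (fun C hC => hC.1.subset_ground)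
  -- a first triangle and the triangles disjoint from it
  obtain ⟨E₁, hE₁⟩ : 𝒯.Nonempty := Set.nonempty_of_ncard_ne_zero (by omega)
  set 𝒟₁ := {C : Set α | M.IsCircuit C ∧ C.ncard = 3 ∧ Disjoint C E₁} with h𝒟₁
  have h𝒟₁fin : 𝒟₁.Finite := h𝒯fin.subset (fun C hC => ⟨hC.1, hC.2.1⟩)
  have h4 : 𝒯.ncard ≤ 4 + 𝒟₁.ncard := ncard_triangles_le_four_add_disjoint M hC1 h9 hE₁.1 hE₁.2
  obtain ⟨E₂, hE₂⟩ : 𝒟₁.Nonempty := Set.nonempty_of_ncard_ne_zero (by omega)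
  -- the triangles meeting `E₁` / `E₂`
  set 𝒩₁ := {C : Set α | M.IsCircuit C ∧ C.ncard = 3 ∧ C ≠ E₁ ∧ ¬ Disjoint C E₁} with h𝒩₁
  set 𝒩₂ := {C : Set α | M.IsCircuit C ∧ C.ncard = 3 ∧ C ≠ E₂ ∧ ¬ Disjoint C E₂} with h𝒩₂
  have h𝒩₁fin : 𝒩₁.Finite := h𝒯fin.subset (fun C hC => ⟨hC.1, hC.2.1⟩)
  have h𝒩₂fin : 𝒩₂.Finite := h𝒯fin.subset (fun C hC => ⟨hC.1, hC.2.1⟩)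
  have hN₁3 : 𝒩₁.ncard ≤ 3 := ncard_triangles_meeting_le_three M hC1 h9 hE₁.1 hE₁.2
  have hN₂3 : 𝒩₂.ncard ≤ 3 := ncard_triangles_meeting_le_three M hC1 h9 hE₂.1 hE₂.2.1
  -- `𝒯 ⊆ {E₁} ∪ 𝒩₁ ∪ 𝒟₁`
  have hcover : 𝒯 ⊆ ({E₁} ∪ 𝒩₁) ∪ 𝒟₁ := by
    intro C hC
    by_cases hne : C = E₁
    · exact Or.inl (Or.inl (Set.mem_singleton_iff.2 hne))
    by_cases hdis : Disjoint C E₁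
    · exact Or.inr ⟨hC.1, hC.2, hdis⟩
    · exact Or.inl (Or.inr ⟨hC.1, hC.2, hne, hdis⟩)
  have hle1 := Set.ncard_le_ncard hcover (((Set.finite_singleton E₁).union h𝒩₁fin).union h𝒟₁fin)
  have hu1 := Set.ncard_union_le ({E₁} ∪ 𝒩₁) 𝒟₁
  have hu2 := Set.ncard_union_le ({E₁} : Set (Set α)) 𝒩₁
  rw [Set.ncard_singleton] at hu2
  -- `𝒟₁ ⊆ {E₂} ∪ 𝒩₂` (no third disjoint triangle)
  have hcover2 : 𝒟₁ ⊆ {E₂} ∪ 𝒩₂ := by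
    intro C hC
    by_cases hne : C = E₂
    · exact Or.inl (Set.mem_singleton_iff.2 hne)
    refine Or.inr ⟨hC.1, hC.2.1, hne, fun hdis => hno ⟨E₁, C, E₂, hE₁.1, hE₁.2, hC.1, hC.2.1, hE₂.1, hE₂.2.1,
      hC.2.2.symm, hE₂.2.2.symm, hdis⟩⟩
  have hle2 := Set.ncard_le_ncard hcover2 ((Set.finite_singleton E₂).union h𝒩₂fin)
  have hu3 := Set.ncard_union_le ({E₂} : Set (Set α)) 𝒩₂
  rw [Set.ncard_singleton] at hu3
  -- the counts: `|𝒩₁| ≥ t − 5 ≥ 1`, `|𝒩₂| ≥ t − 5 ≥ 1`; for `t ≥ 7` both `≥ 2`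
  have hN₁1 : 1 ≤ 𝒩₁.ncard := by omega
  have hN₂1 : 1 ≤ 𝒩₂.ncard := by omega
  -- the generic pieces: a cluster with `ν ≥ 3` keeps every triangle inside or disjoint
  have hfinT : ∀ {T : Set α}, M.IsCircuit T → T.Finite := fun hT => M.ground_finite.subset hT.subset_ground
  have hdisj_of_cluster : ∀ {E F₁ F₂ : Set α}, M.IsCircuit E → E.ncard = 3 →
      M.IsCircuit F₁ → F₁.ncard = 3 → F₁ ≠ E → ¬ Disjoint F₁ E →
      M.IsCircuit F₂ → F₂.ncard = 3 → F₂ ≠ E → ¬ Disjoint F₂ E → F₁ ≠ F₂ →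
      ∀ {E' : Set α}, M.IsCircuit E' → E'.ncard = 3 → Disjoint E' E → Disjoint E' (E ∪ F₁ ∪ F₂) := by
    intro E F₁ F₂ hE hE3 hF₁ hF₁3 hF₁E hF₁m hF₂ hF₂3 hF₂E hF₂m h12 E' hE' hE'3 hdis
    obtain ⟨hW7, hW3⟩ := cluster_of_two_meeting M hC1 hE hE3 hF₁ hF₁3 hF₁E hF₁m hF₂ hF₂3 hF₂E hF₂m h12
    have hWE : E ∪ F₁ ∪ F₂ ⊆ M.E :=
      Set.union_subset (Set.union_subset hE.subset_ground hF₁.subset_ground) hF₂.subset_ground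
    rcases triangle_subset_or_disjoint_of_cluster M h9 hWE hW7 hW3 hE' hE'3 with h | h
    · exact absurd h (not_subset_cluster_of_disjoint M hC1 hF₁ hF₁3 hF₁m hF₂ hF₂3 hF₂m hE' hE'3 hdis)
    · exact h
  -- a triangle meeting a triangle `E'` that is disjoint from a `ν ≥ 3` cluster is itself disjoint from the cluster
  have hdisj_meet : ∀ {W E' G : Set α}, W ⊆ M.E → W.ncard ≤ 7 → M.eRk W + 3 ≤ W.encard → Disjoint E' W →
      M.IsCircuit G → G.ncard = 3 → ¬ Disjoint G E' → Disjoint G W := by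
    intro W E' G hWE hW7 hW3 hE'W hG hG3 hGm
    rcases triangle_subset_or_disjoint_of_cluster M h9 hWE hW7 hW3 hG hG3 with h | h
    · exfalso
      obtain ⟨x, hxG, hxE'⟩ := Set.not_disjoint_iff.1 hGm
      exact Set.disjoint_left.1 hE'W hxE' (h hxG)
    · exact h
  -- CASE A: two triangles meet `E₁`
  by_cases hN₁2 : 2 ≤ 𝒩₁.ncard
  · obtain ⟨F₁, F₂, hF₁, hF₂, h12⟩ := (Set.one_lt_ncard_iff h𝒩₁fin).1 (by omega)
    obtain ⟨hW₁7, hW₁3⟩ := cluster_of_two_meeting M hC1 hE₁.1 hE₁.2 hF₁.1 hF₁.2.1 hF₁.2.2.1 hF₁.2.2.2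
      hF₂.1 hF₂.2.1 hF₂.2.2.1 hF₂.2.2.2 h12
    set W₁ := E₁ ∪ F₁ ∪ F₂ with hW₁
    have hW₁E : W₁ ⊆ M.E :=
      Set.union_subset (Set.union_subset hE₁.1.subset_ground hF₁.1.subset_ground) hF₂.1.subset_ground
    have hE₂W₁ : Disjoint E₂ W₁ := hdisj_of_cluster hE₁.1 hE₁.2 hF₁.1 hF₁.2.1 hF₁.2.2.1 hF₁.2.2.2
      hF₂.1 hF₂.2.1 hF₂.2.2.1 hF₂.2.2.2 h12 hE₂.1 hE₂.2.1 hE₂.2.2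
    -- the members of `𝒩₂` are disjoint from `W₁`
    have hGW₁ : ∀ {G : Set α}, G ∈ 𝒩₂ → Disjoint G W₁ := fun hG =>
      hdisj_meet hW₁E hW₁7 hW₁3 hE₂W₁ hG.1 hG.2.1 hG.2.2.2
    by_cases hN₂2 : 2 ≤ 𝒩₂.ncard
    · obtain ⟨G₁, G₂, hG₁, hG₂, hg12⟩ := (Set.one_lt_ncard_iff h𝒩₂fin).1 (by omega)
      obtain ⟨hW₂7, hW₂3⟩ := cluster_of_two_meeting M hC1 hE₂.1 hE₂.2.1 hG₁.1 hG₁.2.1 hG₁.2.2.1 hG₁.2.2.2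
        hG₂.1 hG₂.2.1 hG₂.2.2.1 hG₂.2.2.2 hg12
      refine ⟨W₁, E₂ ∪ G₁ ∪ G₂, 3, 3, hW₁E,
        Set.union_subset (Set.union_subset hE₂.1.subset_ground hG₁.1.subset_ground) hG₂.1.subset_ground,
        ?_, hW₁7, hW₂7, hW₁3, hW₂3, Or.inl ⟨rfl, rfl⟩, fun _ => ⟨rfl, rfl⟩⟩
      exact (Set.disjoint_union_left.2 ⟨Set.disjoint_union_left.2 ⟨hE₂W₁, hGW₁ hG₁⟩, hGW₁ hG₂⟩).symm
    · -- `|𝒩₂| = 1`: the small cluster `E₂ ∪ G₁`; then `t ≤ 6`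
      push Not at hN₂2
      obtain ⟨G₁, hG₁⟩ : 𝒩₂.Nonempty := Set.nonempty_of_ncard_ne_zero (by omega)
      obtain ⟨hW₂5, hW₂2⟩ := cluster_of_one_meeting M hC1 hE₂.1 hE₂.2.1 hG₁.1 hG₁.2.1 hG₁.2.2.1 hG₁.2.2.2
      refine ⟨W₁, E₂ ∪ G₁, 3, 2, hW₁E, Set.union_subset hE₂.1.subset_ground hG₁.1.subset_ground, ?_, hW₁7,
        by omega, hW₁3, hW₂2, Or.inr (Or.inl ⟨rfl, rfl, hW₂5⟩), fun h7 => ?_⟩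
      · exact (Set.disjoint_union_left.2 ⟨hE₂W₁, hGW₁ hG₁⟩).symm
      · exfalso; omega
  · -- CASE B: exactly one triangle meets `E₁`; then `|𝒟₁| ≥ 4` and two triangles meet `E₂`
    push Not at hN₁2
    have hN₂2 : 2 ≤ 𝒩₂.ncard := by omega
    obtain ⟨F₁, hF₁⟩ : 𝒩₁.Nonempty := Set.nonempty_of_ncard_ne_zero (by omega)
    obtain ⟨G₁, G₂, hG₁, hG₂, hg12⟩ := (Set.one_lt_ncard_iff h𝒩₂fin).1 (by omega)
    obtain ⟨hW₂7, hW₂3⟩ := cluster_of_two_meeting M hC1 hE₂.1 hE₂.2.1 hG₁.1 hG₁.2.1 hG₁.2.2.1 hG₁.2.2.2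
      hG₂.1 hG₂.2.1 hG₂.2.2.1 hG₂.2.2.2 hg12
    set W₂ := E₂ ∪ G₁ ∪ G₂ with hW₂
    have hW₂E : W₂ ⊆ M.E :=
      Set.union_subset (Set.union_subset hE₂.1.subset_ground hG₁.1.subset_ground) hG₂.1.subset_ground
    have hE₁W₂ : Disjoint E₁ W₂ := hdisj_of_cluster hE₂.1 hE₂.2.1 hG₁.1 hG₁.2.1 hG₁.2.2.1 hG₁.2.2.2
      hG₂.1 hG₂.2.1 hG₂.2.2.1 hG₂.2.2.2 hg12 hE₁.1 hE₁.2 hE₂.2.2.symm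
    have hF₁W₂ : Disjoint F₁ W₂ := hdisj_meet hW₂E hW₂7 hW₂3 hE₁W₂ hF₁.1 hF₁.2.1 hF₁.2.2.2
    obtain ⟨hW₁5, hW₁2⟩ := cluster_of_one_meeting M hC1 hE₁.1 hE₁.2 hF₁.1 hF₁.2.1 hF₁.2.2.1 hF₁.2.2.2
    refine ⟨E₁ ∪ F₁, W₂, 2, 3, Set.union_subset hE₁.1.subset_ground hF₁.1.subset_ground, hW₂E,
      Set.disjoint_union_left.2 ⟨hE₁W₂, hF₁W₂⟩, by omega, hW₂7, hW₁2, hW₂3, Or.inr (Or.inr ⟨rfl, rfl, hW₁5⟩),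
      fun h7 => ?_⟩
    exfalso; omega

/-- **The top sets against two clusters** (corank `6`): with disjoint `W₁, W₂ ⊆ E` of nullities `≥ k₁, k₂`, every top `6`-set has
`≥ k₁ + k₂` points in `W₁ ∪ W₂` and every top `5`-set `≥ k₁ + k₂ − 2`; the counts by `S2.ncard_subsets_inter_ge_le`. -/
theorem top_sets_le_of_clusters (M : Matroid α) [M.Finite] {p : ℕ} (hR : M.eRank = (p : ℕ∞)) (hn : M.E.ncard = p + 6)
    {W₁ W₂ : Set α} {k₁ k₂ : ℕ} (hW₁ : W₁ ⊆ M.E) (hW₂ : W₂ ⊆ M.E) (hdis : Disjoint W₁ W₂)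
    (hk₁ : M.eRk W₁ + k₁ ≤ W₁.encard) (hk₂ : M.eRk W₂ + k₂ ≤ W₂.encard) :
    {B : Set α | B ⊆ M.E ∧ B.ncard = 6 ∧ M.eRk B = 5 ∧ M.eRk (M.E \ B) = M.eRank}.ncard ≤
        ∑ j ∈ Finset.Icc (k₁ + k₂) 6, (W₁ ∪ W₂).ncard.choose j * ((p + 6) - (W₁ ∪ W₂).ncard).choose (6 - j) ∧
      {B : Set α | B ⊆ M.E ∧ B.ncard = 5 ∧ M.eRk B = 5 ∧ M.eRk (M.E \ B) = M.eRank}.ncard ≤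
        ∑ j ∈ Finset.Icc (k₁ + k₂ - 2) 5, (W₁ ∪ W₂).ncard.choose j * ((p + 6) - (W₁ ∪ W₂).ncard).choose (5 - j) := by
  classical
  have hEfin := M.ground_finite
  set W := W₁ ∪ W₂ with hW
  have hWE : W ⊆ M.E := Set.union_subset hW₁ hW₂
  have hWfin : W.Finite := hEfin.subset hWE
  have hWF : hWfin.toFinset ⊆ hEfin.toFinset := Set.Finite.toFinset_subset_toFinset.2 hWE
  have hWcard : hWfin.toFinset.card = W.ncard := (Set.ncard_eq_toFinset_card W hWfin).symm
  have hEcard : hEfin.toFinset.card = p + 6 := by rw [← Set.ncard_eq_toFinset_card _ hEfin]; exact hn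
  -- `|B ∩ W| = |B ∩ W₁| + |B ∩ W₂|`
  have hsplit : ∀ B : Set α, B ⊆ M.E → (B ∩ W).ncard = (B ∩ W₁).ncard + (B ∩ W₂).ncard := by
    intro B hB
    have hBfin : B.Finite := hEfin.subset hB
    rw [hW, Set.inter_union_distrib_left]
    exact Set.ncard_union_eq (hdis.mono Set.inter_subset_right Set.inter_subset_right)
      (hBfin.subset Set.inter_subset_left) (hBfin.subset Set.inter_subset_left)
  constructor
  · have hsub : {B : Set α | B ⊆ M.E ∧ B.ncard = 6 ∧ M.eRk B = 5 ∧ M.eRk (M.E \ B) = M.eRank} ⊆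
        {X : Set α | X ⊆ (hEfin.toFinset : Set α) ∧ X.ncard = 6 ∧ k₁ + k₂ ≤ (X ∩ (hWfin.toFinset : Set α)).ncard} := by
      rintro B ⟨hBE, hB6, -, hBs⟩
      refine ⟨by rw [Set.Finite.coe_toFinset]; exact hBE, hB6, ?_⟩
      rw [Set.Finite.coe_toFinset, hsplit B hBE]
      have h1 := cobasis_inter_ge_of_nullity M hR hn hBE hB6 hBs hW₁ hk₁
      have h2 := cobasis_inter_ge_of_nullity M hR hn hBE hB6 hBs hW₂ hk₂
      omega
    have hle := Set.ncard_le_ncard hsub ((hEfin.toFinset.finite_toSet.finite_subsets).subset (fun X hX => hX.1))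
    have hc := ncard_subsets_inter_ge_le hEfin.toFinset hWfin.toFinset hWF 6 (k₁ + k₂)
    rw [hWcard, hEcard] at hc
    exact hle.trans hc
  · have hsub : {B : Set α | B ⊆ M.E ∧ B.ncard = 5 ∧ M.eRk B = 5 ∧ M.eRk (M.E \ B) = M.eRank} ⊆
        {X : Set α | X ⊆ (hEfin.toFinset : Set α) ∧ X.ncard = 5 ∧ k₁ + k₂ - 2 ≤ (X ∩ (hWfin.toFinset : Set α)).ncard} := by
      rintro B ⟨hBE, hB5, -, hBs⟩
      refine ⟨by rw [Set.Finite.coe_toFinset]; exact hBE, hB5, ?_⟩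
      rw [Set.Finite.coe_toFinset, hsplit B hBE]
      have h1 := top_five_inter_ge_of_nullity M hR hn hBE hB5 hBs hW₁ hk₁
      have h2 := top_five_inter_ge_of_nullity M hR hn hBE hB5 hBs hW₂ hk₂
      omega
    have hle := Set.ncard_le_ncard hsub ((hEfin.toFinset.finite_toSet.finite_subsets).subset (fun X hX => hX.1))
    have hc := ncard_subsets_inter_ge_le hEfin.toFinset hWfin.toFinset hWF 5 (k₁ + k₂ - 2)
    rw [hWcard, hEcard] at hc
    exact hle.trans hc

/-- **A triangle met by three distinct triangles spans a `6`-point cluster**: `|E ∪ F₁ ∪ F₂| ≤ 6` (the third one forces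
`F₁ ∖ E` and `F₂ ∖ E` to share a point — the symmetric-difference argument of `not_four_triangles_meeting`). -/
theorem ncard_cluster_le_six_of_three_meeting (M : Matroid α) [M.Finite]
    (hC1 : ∀ L ⊆ M.E, M.eRk L = 2 → L.ncard ≤ 3)
    (h9 : ∀ X ⊆ M.E, X.ncard ≤ 9 → X.encard ≤ M.eRk X + 3)
    {E F₁ F₂ F₃ : Set α} (hE : M.IsCircuit E) (hE3 : E.ncard = 3)
    (hF₁ : M.IsCircuit F₁) (hF₁3 : F₁.ncard = 3) (hF₁E : F₁ ≠ E) (hF₁m : ¬ Disjoint F₁ E)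
    (hF₂ : M.IsCircuit F₂) (hF₂3 : F₂.ncard = 3) (hF₂E : F₂ ≠ E) (hF₂m : ¬ Disjoint F₂ E)
    (hF₃ : M.IsCircuit F₃) (hF₃3 : F₃.ncard = 3) (hF₃E : F₃ ≠ E) (hF₃m : ¬ Disjoint F₃ E)
    (h13 : F₁ ≠ F₃) (h23 : F₂ ≠ F₃) : (E ∪ F₁ ∪ F₂).ncard ≤ 6 := by
  have hEfin := M.ground_finite
  have hEf : E.Finite := hEfin.subset hE.subset_ground
  have hF₁f : F₁.Finite := hEfin.subset hF₁.subset_ground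
  have hF₂f : F₂.Finite := hEfin.subset hF₂.subset_ground
  have hF₃f : F₃.Finite := hEfin.subset hF₃.subset_ground
  -- `F₁ ⊆ E ∪ F₃ ∪ F₂` and `F₂ ⊆ E ∪ F₃ ∪ F₁`: the symmetric difference of `P₁ = F₁ ∖ E`, `P₂ = F₂ ∖ E` lies in `P₃`
  have c1 : F₁ ⊆ E ∪ F₃ ∪ F₂ :=
    subset_union_of_triangles_meeting M hC1 h9 hE hE3 hF₃ hF₃3 hF₃E hF₃m hF₂ hF₂3 hF₂E hF₂m hF₁ hF₁3 hF₁E hF₁m (Ne.symm h23)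
  have c2 : F₂ ⊆ E ∪ F₃ ∪ F₁ :=
    subset_union_of_triangles_meeting M hC1 h9 hE hE3 hF₃ hF₃3 hF₃E hF₃m hF₁ hF₁3 hF₁E hF₁m hF₂ hF₂3 hF₂E hF₂m (Ne.symm h13)
  have e1 := ncard_sdiff_eq_two_of_triangles_meeting M hC1 hE hE3 hF₁ hF₁3 hF₁E hF₁m
  have e2 := ncard_sdiff_eq_two_of_triangles_meeting M hC1 hE hE3 hF₂ hF₂3 hF₂E hF₂m
  have e3 := ncard_sdiff_eq_two_of_triangles_meeting M hC1 hE hE3 hF₃ hF₃3 hF₃E hF₃m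
  have hD : (F₁ \ E) \ (F₂ \ E) ∪ (F₂ \ E) \ (F₁ \ E) ⊆ F₃ \ E := by
    intro y hy
    simp only [Set.mem_union, Set.mem_sdiff, not_and, not_not] at hy ⊢
    rcases hy with ⟨⟨hy1, hyE⟩, hy2⟩ | ⟨⟨hy2, hyE⟩, hy1⟩
    · refine ⟨?_, hyE⟩
      rcases c1 hy1 with (h | h) | h
      · exact absurd h hyE
      · exact h
      · exact absurd h (fun h' => hyE (hy2 h'))
    · refine ⟨?_, hyE⟩
      rcases c2 hy2 with (h | h) | h
      · exact absurd h hyE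
      · exact h
      · exact absurd h (fun h' => hyE (hy1 h'))
  have hP₁fin : (F₁ \ E).Finite := hF₁f.subset Set.sdiff_subset
  have hP₂fin : (F₂ \ E).Finite := hF₂f.subset Set.sdiff_subset
  have hP₃fin : (F₃ \ E).Finite := hF₃f.subset Set.sdiff_subset
  have hs1 := Set.ncard_inter_add_ncard_sdiff_eq_ncard (F₁ \ E) (F₂ \ E) hP₁fin
  have hs2 := Set.ncard_inter_add_ncard_sdiff_eq_ncard (F₂ \ E) (F₁ \ E) hP₂fin
  rw [Set.inter_comm] at hs2
  have hDcard := Set.ncard_union_eq (disjoint_sdiff_sdiff (x := F₁ \ E) (y := F₂ \ E))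
    (hP₁fin.subset Set.sdiff_subset) (hP₂fin.subset Set.sdiff_subset)
  have hD3 := Set.ncard_le_ncard hD hP₃fin
  -- so `|P₁ ∩ P₂| ≥ 1` and `|P₁ ∪ P₂| ≤ 3`
  have hi : 1 ≤ ((F₁ \ E) ∩ (F₂ \ E)).ncard := by omega
  have hu := Set.ncard_union_add_ncard_inter (F₁ \ E) (F₂ \ E) hP₁fin hP₂fin
  have hsub : E ∪ F₁ ∪ F₂ ⊆ E ∪ ((F₁ \ E) ∪ (F₂ \ E)) := by
    intro y hy
    simp only [Set.mem_union, Set.mem_sdiff] at hy ⊢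
    tauto
  have hle := Set.ncard_le_ncard hsub (hEf.union (hP₁fin.union hP₂fin))
  have hu2 := Set.ncard_union_le E ((F₁ \ E) ∪ (F₂ \ E))
  omega

end S2

end PercRepro
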